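import Summits.ResolutionOfSingularities.ResolutionOfSingularities.Theorems.FrobeniusLadderFRationalResolutionConeNormalForm
import Summits.ResolutionOfSingularities.ResolutionOfSingularities.Theorems.FrobeniusLadderFRationalResolutionAdaptedBasisOrthant
import Summits.ResolutionOfSingularities.ResolutionOfSingularities.Theorems.FrobeniusLadderFRationalResolutionChartAlgebraOrthantPoints
import Summits.ResolutionOfSingularities.ResolutionOfSingularities.Theorems.FrobeniusLadderFRationalResolutionBaseChartAlgebra
import Summits.ResolutionOfSingularities.ResolutionOfSingularities.Theorems.FrobeniusLadderFRationalResolutionLogClosedStratumPoint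
import HarnessLib

/-!
# Crux `FrobeniusLadder.FRationalResolution` (stmt-ResolutionOfSingularities-15317), line `redirect`,
# stub `stub_diagonalizableQuotientResolution` — **round 0 of the point-blow-up recursion: a SINGULAR point
# of a surface under a sharp rank-two log regular chart is a cone chart algebra point in normal form**
# (the entry of `…ConeChainCharts.round_charts` / `…not_isRegularLocalRing_chart_fixedPrime`, with
# `(C, Q, χ) := (A, P, φ)` via `…BaseChartAlgebra`; surface case over arbitrary fields)

DATA: a Noetherian ring `A`, a prime `𝔭` with `dim A_𝔭 ≤ 2`, a chart `φ : P → A`, `P ⊆ ℤ²` finitely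
generated, saturated and spanning, Kato-log-regular at `𝔭` with UNIT FACE `0` (`φ(P ∖ 0) ⊆ 𝔭`) — the
shape produced at every point of a quotient chart by `…IsolatedQuotientResolution.exists_sharp_affine_chart`
once the rank is `2`. RESULTS:

* `span_faceMonoid_eq_bot`, `sharp_of_face_zero` — unit face `0` makes `ℤF_𝔭 = 0` and `P` sharp;
* `isRegularLocalRing_of_free` — if `P` is the free cone `{m u + l e : m, l ≥ 0}` then `A_𝔭` is regular
  (Kato (10.3) via `…ChartAlgebraOrthantPoints` for the base chart);
* **`exists_normalForm_of_not_isRegularLocalRing`** — if `A_𝔭` is NOT regular then, in a `ℤ`-basis `(u, e)`,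
  `P = ℤF_𝔭 + {m u + l e : l ≥ 0, a l ≤ d m}` with `0 < a < d` (so `d ≥ 2`), the stratum of `𝔭` is a point
  (`𝔪_{A_𝔭} = I(𝔭)A_𝔭`) and `dim A_𝔭 ≤ 2` — exactly the hypotheses `hQ`/`hind`/`hspan`/`h0`/`hdimA` of the
  ring-level round `…ConeChainCharts` for `(C, Q, χ) = (A, P, φ)`, with measure `d`.

Honest label: assembly toward ONE leaf stub (no stub, crux or summit closed). No definitions, no named facts,
no sorry. [cite: Kato1994, Def. (2.1), (10.1), (10.3)] [cite: Fulton1993Toric, §2.2]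
-/

noncomputable section

-- single-problem summit: the doubled namespace component is forced
set_option linter.dupNamespace false

open IsLocalRing Literature.AlgebraicGeometry.Resolution Literature.AlgebraicGeometry.Resolution.LogChart
  Literature.AlgebraicGeometry.Resolution.LogRefinedChart
open Summit.ResolutionOfSingularities.ResolutionOfSingularities.Theorems.FRationalResolution.ChartAlgebraOrthantPoints
open Summit.ResolutionOfSingularities.ResolutionOfSingularities.Theorems.FRationalResolution.AdaptedBasisOrthant
open Summit.ResolutionOfSingularities.ResolutionOfSingularities.Theorems.FRationalResolution.BaseChartAlgebra
open Summit.ResolutionOfSingularities.ResolutionOfSingularities.Theorems.FRationalResolution.LogClosedStratumPoint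

namespace Summit.ResolutionOfSingularities.ResolutionOfSingularities.Theorems.FRationalResolution.ConeChartEntry

universe u

variable {A : Type u} [CommRing A] {n : ℕ} {P : AddSubmonoid (Fin n → ℤ)} {φ : Multiplicative P →* A}
  {𝔭 : Ideal A} [𝔭.IsPrime]

/-! ### Unit face `0` -/

/-- With unit face `0` the face group `ℤF_𝔭` is trivial. [cite: Kato1994, Def. (2.1)] -/
theorem span_faceMonoid_eq_bot (hface : ∀ p : P, (p : Fin n → ℤ) ≠ 0 → φ (Multiplicative.ofAdd p) ∈ 𝔭) :
    ∀ g ∈ Submodule.span ℤ (faceMonoid P φ 𝔭 : Set (Fin n → ℤ)), g = 0 := by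
  have hsub : (faceMonoid P φ 𝔭 : Set (Fin n → ℤ)) ⊆ {0} := by
    intro v hv
    rw [SetLike.mem_coe, mem_faceMonoid] at hv
    obtain ⟨hvP, hval⟩ := hv
    by_contra hv0
    rw [val_of_mem P φ hvP] at hval
    exact hval (hface ⟨v, hvP⟩ hv0)
  intro g hg
  have : g ∈ (⊥ : Submodule ℤ (Fin n → ℤ)) := by
    refine (Submodule.span_le.2 ?_) hg
    intro v hv
    rw [hsub hv]; exact Submodule.zero_mem _
  simpa using this

/-- With unit face `0` the chart monoid is sharp. [cite: Kato1994, Def. (2.1)] -/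
theorem sharp_of_face_zero (hface : ∀ p : P, (p : Fin n → ℤ) ≠ 0 → φ (Multiplicative.ofAdd p) ∈ 𝔭) :
    ∀ p ∈ P, -p ∈ P → p = 0 := by
  intro p hp hnp
  by_contra hp0
  have h1 : φ (Multiplicative.ofAdd ⟨p, hp⟩) * φ (Multiplicative.ofAdd ⟨-p, hnp⟩) = 1 := by
    rw [← map_mul, ← ofAdd_add]
    have : (⟨p, hp⟩ : P) + ⟨-p, hnp⟩ = 0 := Subtype.ext (add_neg_cancel p)
    rw [this, ofAdd_zero, map_one]
  have hmem : φ (Multiplicative.ofAdd ⟨p, hp⟩) * φ (Multiplicative.ofAdd ⟨-p, hnp⟩) ∈ 𝔭 :=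
    Ideal.mul_mem_right _ _ (hface ⟨p, hp⟩ hp0)
  rw [h1] at hmem
  exact Ideal.IsPrime.ne_top' (Ideal.eq_top_of_isUnit_mem _ hmem isUnit_one)

/-- The rank term of Kato's (2.1) is `n` when the unit face is `0`. [cite: Kato1994, Def. (2.1)] -/
theorem finrank_span_face_eq_zero (hface : ∀ p : P, (p : Fin n → ℤ) ≠ 0 → φ (Multiplicative.ofAdd p) ∈ 𝔭) :
    Module.finrank ℤ (Submodule.span ℤ ((fun p : P => (p : Fin n → ℤ)) '' face P φ 𝔭)) = 0 := by
  rw [coe_image_face_eq]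
  have : Submodule.span ℤ (faceMonoid P φ 𝔭 : Set (Fin n → ℤ)) = ⊥ := by
    rw [Submodule.eq_bot_iff]; exact span_faceMonoid_eq_bot hface
  rw [this, finrank_bot]

/-! ### Free cones are regular points -/

variable [IsNoetherianRing A]

/-- **A free cone chart gives a regular point** (Kato (10.3) for the base chart): if `(A, φ)` is log
regular at `𝔭` and `P = ℤF_𝔭 + {m u + l e : m, l ≥ 0}` for `(u, e)` independent modulo `ℤF_𝔭` and spanning,
then `A_𝔭` is regular. [cite: Kato1994, (10.3)] -/
theorem isRegularLocalRing_of_free (hP : P.FG)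
    (hsat : ∀ (w : Fin n → ℤ) (k : ℕ), 0 < k → k • w ∈ P → w ∈ P)
    (hspanP : Submodule.span ℤ (P : Set (Fin n → ℤ)) = ⊤) {u e : Fin n → ℤ}
    (hind : ∀ g ∈ Submodule.span ℤ (faceMonoid P φ 𝔭 : Set (Fin n → ℤ)), ∀ m l : ℤ,
      g + m • u + l • e = 0 → m = 0 ∧ l = 0)
    (hspan : ∀ w : Fin n → ℤ, ∃ g ∈ Submodule.span ℤ (faceMonoid P φ 𝔭 : Set (Fin n → ℤ)),
      ∃ m l : ℤ, w = g + m • u + l • e)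
    (hfree : ∀ w, w ∈ P ↔ ∃ g ∈ Submodule.span ℤ (faceMonoid P φ 𝔭 : Set (Fin n → ℤ)), ∃ m l : ℤ,
      0 ≤ m ∧ 0 ≤ l ∧ w = g + m • u + l • e)
    (hreg : IsLogRegularAt P φ 𝔭) : IsRegularLocalRing (Localization.AtPrime 𝔭) := by
  classical
  obtain ⟨b, I, hI⟩ := exists_isOrthantLike_of_mem_iff (Q := P) hind hspan {0, 1} (fun w => by
    rw [hfree w]
    constructor
    · rintro ⟨g, hg, m, l, hm, hl, h⟩; exact ⟨g, hg, m, l, fun _ => hm, fun _ => hl, h⟩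
    · rintro ⟨g, hg, m, l, hm, hl, h⟩; exact ⟨g, hg, m, l, hm (by simp), hl (by simp), h⟩)
  have hreg' : IsLogRegularAt P φ ((𝔭 : Ideal A).comap (algebraMap A A)) := by
    have key : ∀ (𝔮 : Ideal A) [𝔮.IsPrime], 𝔮 = 𝔭 → IsLogRegularAt P φ 𝔮 := by
      intro 𝔮 _ h; subst h; exact hreg
    exact key _ (by ext x; simp)
  exact isRegularLocalRing_localization_of_isOrthantLike hP hsat hspanP hI (le_refl P) self_chi
    self_adjoin_eq_top self_fieldExtension 𝔭 hreg'

/-! ### The normal form at a singular point -/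

/-- **Round 0: a singular point under a sharp rank-two chart is a cone chart point in normal form.**
`P ⊆ ℤ²` finitely generated, saturated, spanning; `(A, φ)` log regular at `𝔭` with unit face `0`;
`dim A_𝔭 ≤ 2`; `A_𝔭` not regular. Then `P = ℤF_𝔭 + {m u + l e : l ≥ 0, a l ≤ d m}` in a `ℤ`-basis `(u, e)`
with `0 < a < d`, and the stratum of `𝔭` is a point: `𝔪_{A_𝔭} = I(𝔭)A_𝔭`.
[cite: Kato1994, Def. (2.1), (10.1), (10.3)] [cite: Fulton1993Toric, §2.2] -/
theorem exists_normalForm_of_not_isRegularLocalRing {P : AddSubmonoid (Fin 2 → ℤ)}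
    {φ : Multiplicative P →* A} {𝔭 : Ideal A} [𝔭.IsPrime] (hP : P.FG)
    (hsat : ∀ (w : Fin 2 → ℤ) (k : ℕ), 0 < k → k • w ∈ P → w ∈ P)
    (hspanP : Submodule.span ℤ (P : Set (Fin 2 → ℤ)) = ⊤)
    (hreg : IsLogRegularAt P φ 𝔭) (hface : ∀ p : P, (p : Fin 2 → ℤ) ≠ 0 → φ (Multiplicative.ofAdd p) ∈ 𝔭)
    (hdim : ringKrullDim (Localization.AtPrime 𝔭) ≤ (2 : ℕ))
    (hsing : ¬ IsRegularLocalRing (Localization.AtPrime 𝔭)) :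
    ∃ (u e : Fin 2 → ℤ) (d a : ℕ), 0 < a ∧ a < d ∧
      (∀ g ∈ Submodule.span ℤ (faceMonoid P φ 𝔭 : Set (Fin 2 → ℤ)), ∀ m l : ℤ,
        g + m • u + l • e = 0 → m = 0 ∧ l = 0) ∧
      (∀ w : Fin 2 → ℤ, ∃ g ∈ Submodule.span ℤ (faceMonoid P φ 𝔭 : Set (Fin 2 → ℤ)),
        ∃ m l : ℤ, w = g + m • u + l • e) ∧
      (∀ w, w ∈ P ↔ ∃ g ∈ Submodule.span ℤ (faceMonoid P φ 𝔭 : Set (Fin 2 → ℤ)), ∃ m l : ℤ,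
        0 ≤ l ∧ (a : ℤ) * l ≤ (d : ℤ) * m ∧ w = g + m • u + l • e) ∧
      (ideal P φ 𝔭).map (algebraMap A (Localization.AtPrime 𝔭)) = maximalIdeal (Localization.AtPrime 𝔭) ∧
      ringKrullDim (Localization.AtPrime 𝔭) = (2 : ℕ) := by
  have hL := span_faceMonoid_eq_bot (P := P) (φ := φ) (𝔭 := 𝔭) hface
  obtain ⟨u, e, d, a, had, hind, hspan, hmem⟩ :=
    ConeNormalForm.exists_normalForm P hP hsat hspanP (sharp_of_face_zero hface)
  -- the `ℤF_𝔭`-forms (`ℤF_𝔭 = 0`)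
  have hindL : ∀ g ∈ Submodule.span ℤ (faceMonoid P φ 𝔭 : Set (Fin 2 → ℤ)), ∀ m l : ℤ,
      g + m • u + l • e = 0 → m = 0 ∧ l = 0 := by
    intro g hg m l h
    rw [hL g hg, zero_add] at h
    exact hind m l h
  have hspanL : ∀ w : Fin 2 → ℤ, ∃ g ∈ Submodule.span ℤ (faceMonoid P φ 𝔭 : Set (Fin 2 → ℤ)),
      ∃ m l : ℤ, w = g + m • u + l • e := by
    intro w
    obtain ⟨m, l, rfl⟩ := hspan w
    exact ⟨0, Submodule.zero_mem _, m, l, by rw [zero_add]⟩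
  have hmemL : ∀ w, w ∈ P ↔ ∃ g ∈ Submodule.span ℤ (faceMonoid P φ 𝔭 : Set (Fin 2 → ℤ)), ∃ m l : ℤ,
      0 ≤ l ∧ (a : ℤ) * l ≤ (d : ℤ) * m ∧ w = g + m • u + l • e := by
    intro w
    rw [hmem w]
    constructor
    · rintro ⟨m, l, hl, hml, rfl⟩
      exact ⟨0, Submodule.zero_mem _, m, l, hl, hml, by rw [zero_add]⟩
    · rintro ⟨g, hg, m, l, hl, hml, rfl⟩
      exact ⟨m, l, hl, hml, by rw [hL g hg, zero_add]⟩
  -- `a ≠ 0`: the free cone would make `A_𝔭` regular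
  have ha : 0 < a := by
    rcases Nat.eq_zero_or_pos a with h | h
    · exfalso
      subst h
      have hdpos : (0 : ℤ) < d := by exact_mod_cast had
      refine hsing (isRegularLocalRing_of_free hP hsat hspanP hindL hspanL (fun w => ?_) hreg)
      rw [hmemL w]
      constructor
      · rintro ⟨g, hg, m, l, hl, hml, rfl⟩
        refine ⟨g, hg, m, l, ?_, hl, rfl⟩
        simp only [Nat.cast_zero, zero_mul] at hml
        nlinarith
      · rintro ⟨g, hg, m, l, hm, hl, rfl⟩
        exact ⟨g, hg, m, l, hl, by simp only [Nat.cast_zero, zero_mul]; positivity, rfl⟩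
    · exact h
  -- dimension: `dim A_𝔭 = dim (A_𝔭/I) + 2 ≤ 2`
  have hr := finrank_span_face_eq_zero (P := P) (φ := φ) (𝔭 := 𝔭) hface
  have h2 := hreg.2
  rw [hr, Nat.sub_zero] at h2
  haveI := hreg.1
  have hq0 : (0 : WithBot ℕ∞) ≤ ringKrullDim (Localization.AtPrime 𝔭 ⧸
      (ideal P φ 𝔭).map (algebraMap A (Localization.AtPrime 𝔭))) := ringKrullDim_nonneg_of_nontrivial
  have hdim2 : ringKrullDim (Localization.AtPrime 𝔭) = (2 : ℕ) := by
    refine le_antisymm hdim ?_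
    rw [h2]
    exact le_add_of_nonneg_left hq0
  have hrank : ringKrullDim (Localization.AtPrime 𝔭) = ((2 - Module.finrank ℤ
      (Submodule.span ℤ ((fun p : P => (p : Fin 2 → ℤ)) '' face P φ 𝔭)) : ℕ) : WithBot ℕ∞) := by
    rw [hr, Nat.sub_zero]; exact hdim2
  exact ⟨u, e, d, a, ha, had, hindL, hspanL, hmemL,
    ideal_map_eq_maximalIdeal_of_ringKrullDim_eq_rank P φ 𝔭 hreg hrank, hdim2⟩

end Summit.ResolutionOfSingularities.ResolutionOfSingularities.Theorems.FRationalResolution.ConeChartEntry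

end
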